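import Literature.MathematicalPhysics.QuantumLattice.SSectorNesting
import HarnessLib

/-!
# Adjacency of the angular sectors: non-neighbouring sector weights have disjoint supports; the fat sector
function is a plateau

Topic `MathematicalPhysics/QuantumLattice`.  Benfatto–Giuliani–Mastropietro 2006, §2.5 (2.45) and §2.7
(2.66): the angular partition of unity `ζ̃_{h,ω}` (`sectorWeightCirc n ω`, `N = 2^{n+1}` sectors of width
`w_n = π/2ⁿ` on the circle, each supported within `¾w_n` of its centre modulo `2π`) has the two combinatorial
properties that drive the sector bookkeeping:

* **`sectorWeightCirc_mul_eq_zero_of_not_adjacent`** — if `a ≢ b, b ± 1 (mod N)` then `ζ̃_{n,a} ζ̃_{n,b} ≡ 0`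
  (centres at circular distance `≥ 2w_n`, supports of radius `¾w_n`): only NEIGHBOURING sectors overlap, which is
  why the sectorised covariance `F̃_ω F̃_{ω'} g^{(h)}` is a sum of boundedly many single-sector terms;
* **`sum_adjacent_sectorWeightCirc_eq_one`** — on the support of `ζ̃_{n,ω}` the sum of the (at most three)
  neighbouring weights `ζ̃_{n,ω'}`, `ω' ≡ ω, ω ± 1 (mod N)`, `ω' < N`, equals `1`: the FAT sector function
  `F̃_ω = Σ_{ω' adjacent} ζ̃_{ω'}` is a plateau, `F̃_ω ζ̃_ω = ζ̃_ω` (`fatSectorWeight_mul_sectorWeightCirc`).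

Everything is proved; no definitions (adjacency is the explicit congruence `∃ δ, |δ| ≤ 1 ∧ N ∣ (a - b - δ)`), no
named facts.

## Sources

G. Benfatto, A. Giuliani, V. Mastropietro, Ann. Henri Poincaré 7 (2006) 809–898, §2.5 (2.45), §2.7 (2.66)
(`BenfattoGiulianiMastropietro2006`).
-/

noncomputable section

open Real Set Finset

namespace Literature.MathematicalPhysics.QuantumLattice

/-- **Two sector weights overlapping at an angle have adjacent indices**: if `ζ̃_{n,a}(θ) ≠ 0` and
`ζ̃_{n,b}(θ) ≠ 0` then `a ≡ b + δ (mod N)` for some `δ ∈ {-1, 0, 1}` (`N = 2^{n+1}`). [cite: BenfattoGiulianiMastropietro2006, §2.5 (2.45)] -/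
theorem adjacent_of_sectorWeightCirc_ne_zero {n : ℕ} {a b : ℤ} {θ : ℝ} (ha : sectorWeightCirc n a θ ≠ 0)
    (hb : sectorWeightCirc n b θ ≠ 0) : ∃ δ : ℤ, |δ| ≤ 1 ∧ (sectorCount n : ℤ) ∣ (a - b - δ) := by
  obtain ⟨ka, hka⟩ := exists_abs_lt_of_sectorWeightCirc_ne_zero ha
  obtain ⟨kb, hkb⟩ := exists_abs_lt_of_sectorWeightCirc_ne_zero hb
  have hw := sectorWidth_pos n
  have hN := sectorCount_mul_sectorWidth n
  -- the integer `d = (a - b) + (ka - kb) N` has `|d| w < 3w/2`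
  set d : ℤ := a - b + (ka - kb) * sectorCount n with hd
  have hdw : |(d : ℝ)| * sectorWidth n < 3 * sectorWidth n / 2 := by
    have hdiff : (d : ℝ) * sectorWidth n =
        (θ - ((b : ℝ) + 1 / 2) * sectorWidth n - 2 * π * kb) - (θ - ((a : ℝ) + 1 / 2) * sectorWidth n - 2 * π * ka) := by
      rw [hd]; push_cast; rw [← hN]; ring
    have h1 : |(d : ℝ) * sectorWidth n| < 3 * sectorWidth n / 4 + 3 * sectorWidth n / 4 := by
      rw [hdiff]
      exact (abs_sub _ _).trans_lt (add_lt_add hkb hka)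
    rw [abs_mul, abs_of_pos hw] at h1
    linarith
  have hd1 : |d| ≤ 1 := by
    have h2 : |(d : ℝ)| < 2 := by nlinarith
    have h3 : |d| < 2 := by
      rw [← Int.cast_abs] at h2
      exact_mod_cast h2
    omega
  refine ⟨d, hd1, ⟨kb - ka, ?_⟩⟩
  rw [hd]; ring

/-- **Non-adjacent sector weights have disjoint supports**: if `a ≢ b + δ (mod N)` for every `δ ∈ {-1,0,1}` then
`ζ̃_{n,a}(θ) ζ̃_{n,b}(θ) = 0` for all `θ`. [cite: BenfattoGiulianiMastropietro2006, §2.5 (2.45)] -/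
theorem sectorWeightCirc_mul_eq_zero_of_not_adjacent {n : ℕ} {a b : ℤ}
    (h : ∀ δ : ℤ, |δ| ≤ 1 → ¬ ((sectorCount n : ℤ) ∣ (a - b - δ))) (θ : ℝ) :
    sectorWeightCirc n a θ * sectorWeightCirc n b θ = 0 := by
  by_contra hc
  obtain ⟨δ, hδ, hdvd⟩ := adjacent_of_sectorWeightCirc_ne_zero (left_ne_zero_of_mul hc) (right_ne_zero_of_mul hc)
  exact h δ hδ hdvd

/-- **The fat sector function is a plateau**: on the support of `ζ̃_{n,ω}` the neighbouring weights (indices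
`ω' < N` with `ω' ≡ ω + δ (mod N)`, `|δ| ≤ 1`) sum to `1`. [cite: BenfattoGiulianiMastropietro2006, §2.7 (2.66)] -/
theorem sum_adjacent_sectorWeightCirc_eq_one {n : ℕ} {ω : ℤ} {θ : ℝ}
    [DecidablePred fun ω' : ℕ => ∃ δ : ℤ, |δ| ≤ 1 ∧ (sectorCount n : ℤ) ∣ ((ω' : ℤ) - ω - δ)]
    (h : sectorWeightCirc n ω θ ≠ 0) :
    ∑ ω' ∈ (range (sectorCount n)).filter (fun ω' : ℕ => ∃ δ : ℤ, |δ| ≤ 1 ∧ (sectorCount n : ℤ) ∣ ((ω' : ℤ) - ω - δ)),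
      sectorWeightCirc n ω' θ = 1 := by
  have htot := sum_sectorWeightCirc_eq_one n θ
  rw [← sum_filter_add_sum_filter_not (range (sectorCount n))
    (fun ω' : ℕ => ∃ δ : ℤ, |δ| ≤ 1 ∧ (sectorCount n : ℤ) ∣ ((ω' : ℤ) - ω - δ))] at htot
  have hzero : ∑ ω' ∈ (range (sectorCount n)).filter
      (fun ω' : ℕ => ¬ ∃ δ : ℤ, |δ| ≤ 1 ∧ (sectorCount n : ℤ) ∣ ((ω' : ℤ) - ω - δ)), sectorWeightCirc n ω' θ = 0 := by
    refine sum_eq_zero fun ω' hω' => ?_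
    have hna := (mem_filter.1 hω').2
    have hprod := sectorWeightCirc_mul_eq_zero_of_not_adjacent (n := n) (a := (ω' : ℤ)) (b := ω)
      (fun δ hδ hdvd => hna ⟨δ, hδ, hdvd⟩) θ
    rcases mul_eq_zero.1 hprod with h0 | h0
    · exact h0
    · exact absurd h0 h
  rw [hzero, add_zero] at htot
  convert htot using 2

/-- **`F̃_ω ζ̃_ω = ζ̃_ω`**: the fat sector function times the sector weight is the sector weight.
[cite: BenfattoGiulianiMastropietro2006, §2.7 (2.66)] -/
theorem fatSectorWeight_mul_sectorWeightCirc (n : ℕ) (ω : ℤ) (θ : ℝ)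
    [DecidablePred fun ω' : ℕ => ∃ δ : ℤ, |δ| ≤ 1 ∧ (sectorCount n : ℤ) ∣ ((ω' : ℤ) - ω - δ)] :
    (∑ ω' ∈ (range (sectorCount n)).filter (fun ω' : ℕ => ∃ δ : ℤ, |δ| ≤ 1 ∧ (sectorCount n : ℤ) ∣ ((ω' : ℤ) - ω - δ)),
      sectorWeightCirc n ω' θ) * sectorWeightCirc n ω θ = sectorWeightCirc n ω θ := by
  by_cases h : sectorWeightCirc n ω θ = 0
  · rw [h, mul_zero]
  · rw [sum_adjacent_sectorWeightCirc_eq_one h, one_mul]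

/-- The fat sector function takes values in `[0, 1]`. [folklore] -/
theorem fatSectorWeight_mem_Icc (n : ℕ) (ω : ℤ) (θ : ℝ)
    [DecidablePred fun ω' : ℕ => ∃ δ : ℤ, |δ| ≤ 1 ∧ (sectorCount n : ℤ) ∣ ((ω' : ℤ) - ω - δ)] :
    (∑ ω' ∈ (range (sectorCount n)).filter (fun ω' : ℕ => ∃ δ : ℤ, |δ| ≤ 1 ∧ (sectorCount n : ℤ) ∣ ((ω' : ℤ) - ω - δ)),
      sectorWeightCirc n ω' θ) ∈ Icc (0 : ℝ) 1 := by
  refine ⟨sum_nonneg fun ω' _ => sectorWeightCirc_nonneg n _ θ, ?_⟩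
  calc ∑ ω' ∈ (range (sectorCount n)).filter
        (fun ω' : ℕ => ∃ δ : ℤ, |δ| ≤ 1 ∧ (sectorCount n : ℤ) ∣ ((ω' : ℤ) - ω - δ)), sectorWeightCirc n ω' θ
      ≤ ∑ ω' ∈ range (sectorCount n), sectorWeightCirc n ω' θ :=
        sum_le_sum_of_subset_of_nonneg (filter_subset _ _) fun ω' _ _ => sectorWeightCirc_nonneg n _ θ
    _ = 1 := sum_sectorWeightCirc_eq_one n θ

end Literature.MathematicalPhysics.QuantumLattice
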